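import Mathlib
import Summits.KontsevichZagierPeriods.KontsevichZagierPeriods.Theses.HyperbolicBloch
import Literature.NumberTheory.Transcendental.ZagierDilogarithmConjecture
import Literature.NumberTheory.Transcendental.BlochWignerDilogarithm
import Literature.NumberTheory.Transcendental.BlochWignerDilogarithmVolumeProofs
import Summits.KontsevichZagierPeriods.KontsevichZagierPeriods.Theorems.HyperbolicBlochZagierDilogarithmConjectureStubCyclotomicIndependence
import Summits.KontsevichZagierPeriods.KontsevichZagierPeriods.Theorems.HyperbolicBlochZagierDilogarithmConjectureStubCyclotomicPrimeSectorIff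
import Summits.KontsevichZagierPeriods.KontsevichZagierPeriods.Theorems.HyperbolicBlochZagierDilogarithmConjectureStubMilnorRationalForm
import Summits.KontsevichZagierPeriods.KontsevichZagierPeriods.Theorems.HyperbolicBlochZagierDilogarithmConjectureStubClausenLobachevsky
import Summits.KontsevichZagierPeriods.KontsevichZagierPeriods.Theorems.HyperbolicBlochZagierDilogarithmConjectureStubQuarticSector
import Summits.KontsevichZagierPeriods.KontsevichZagierPeriods.Theorems.HyperbolicBlochZagierDilogarithmConjectureStubSexticSector
import Summits.KontsevichZagierPeriods.KontsevichZagierPeriods.Theorems.HyperbolicBlochZagierDilogarithmConjectureStubSexticKZ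
import Summits.KontsevichZagierPeriods.KontsevichZagierPeriods.Theorems.HyperbolicBlochZagierDilogarithmConjectureStubExplainedToKZ
import HarnessLib

/-!
# `ZagierDilogarithmConjecture` (stmt-KontsevichZagierPeriods-10550) — line
`kummer-clausen-linearisation`, reshape c4: the cyclotomic sector is exactly Milnor's conjecture

**Headline consequences of the c4 stubs, as importable theorems.** Let `ζ_N = e^{2πi/N}`, `D` the
Bloch–Wigner dilogarithm (`D(ζ_N^c) = Cl₂(2πc/N) = 2Л(πc/N)`), and let the crux be the route decl
`ZagierDilogarithmConjecture` (= Zagier's conjecture on `ℚ`-linear relations among values of `D` at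
algebraic arguments, Neumann 1998 §2.1 — an OPEN problem). Then:

* `crux_implies_milnor` — **the crux implies Milnor's conjecture for every `N`** (`ℤ`-form): a relation
  `Σ_c m_c D(ζ_N^c) = 0` supported on the primitive residues `c` of the open upper half
  (`(c, N) = 1`, `0 < c < N/2`) is trivial. Content: the UNCONDITIONAL cyclotomic independence theorem
  `stub_cyclotomicIndependence` (p133984: such a combination lying in `⟨dilogRelators⟩` is zero — Clausen
  character sums `Σ_c χ(c)D(ζ_N^c) ≠ 0` for odd `χ`, via Gauss sums, `L(2, χ̄) ≠ 0` and the distribution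
  relations), to which the crux reduces the relation.
* `crux_implies_milnor_rational` — the same as `LinearIndependent ℚ` (`stub_milnorRationalForm`).
* `crux_implies_milnor_lobachevsky` — the same for Milnor's Lobachevsky values `Л(πc/N)`
  (`stub_clausenLobachevsky`), i.e. Milnor's conjecture verbatim (Milnor 1982, Appendix).
* `cruxCyclotomicPrime_iff_milnor` — for a prime `p`, the crux RESTRICTED to `p`-th roots of unity is
  EQUIVALENT to Milnor's conjecture for `p` (`stub_cyclotomicPrimeSector_iff`).
* `lowOrderSectors` — the crux holds OUTRIGHT on `μ_N ∩ ℍ⁺` for `N ∣ 4` and `N ∣ 6`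
  (`stub_quarticSector`, `stub_sexticSector`); for all other `N` it contains the open Milnor conjecture.

So on the cyclotomic Bloch part (where the Dehn invariant is blind) the residual open core of the line,
`stub_galoisPropagation`, is exactly Milnor's conjecture — no more, no less — and the relator group of the
crux is certified to be the right one there (no unexpected explained relations).
Sorry-free; axioms ⊆ {propext, Classical.choice, Quot.sound}.
[cite: Neumann1998, §2.1] [cite: Milnor1982, Appendix]
-/

noncomputable section

open scoped BigOperators ComplexConjugate
open Literature.NumberTheory.Transcendental

namespace Summit.KontsevichZagierPeriods.HyperbolicBloch.ZagierDilogarithmCyclotomic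

namespace CyclotomicMilnor

/-- The route decl is verbatim the inline form of the named open conjecture. [folklore] -/
theorem crux_iff_relationsConjecture :
    Summit.KontsevichZagierPeriods.KontsevichZagierPeriods.Theses.HyperbolicBloch.ZagierDilogarithmConjecture ↔
      ZagierDilogarithmRelationsConjecture :=
  ⟨fun h => ZagierDilogarithmRelationsConjecture.of_inline idealTetrahedron (fun _ => rfl)
      (h idealTetrahedron (fun _ => rfl)),
    fun h T hT => h.inline T hT⟩

/-- Powers of `ζ_N` are algebraic. [folklore] -/
theorem isAlgebraic_zeta_pow (N : ℕ) [NeZero N] (k : ℕ) :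
    IsAlgebraic ℚ (Complex.exp (2 * Real.pi * Complex.I / N) ^ k) := by
  have hζ := Complex.isPrimitiveRoot_exp N (NeZero.ne N)
  refine ⟨Polynomial.X ^ N - Polynomial.C 1, Polynomial.X_pow_sub_C_ne_zero (NeZero.pos N) 1, ?_⟩
  rw [map_sub, map_pow, Polynomial.aeval_X, Polynomial.aeval_C, map_one, ← pow_mul, pow_mul',
    hζ.pow_eq_one, one_pow, sub_self]

end CyclotomicMilnor

open CyclotomicMilnor

/-- **The crux implies Milnor's conjecture, for every `N` (`ℤ`-form).** If Zagier's dilogarithm conjecture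
holds, then the Clausen values `Cl₂(2πc/N) = D(ζ_N^c)` at the primitive residues `c` of the open upper half
(`(c, N) = 1`, `0 < c < N/2`) admit no non-trivial `ℤ`-relation: the crux makes the formal combination
`Σ_c m_c[ζ_N^c]` explained, and `stub_cyclotomicIndependence` says an explained primitive combination is
zero. [cite: Neumann1998, §2.1] -/
theorem crux_implies_milnor :
    Summit.KontsevichZagierPeriods.KontsevichZagierPeriods.Theses.HyperbolicBloch.ZagierDilogarithmConjecture →
    ∀ (N : ℕ) [NeZero N] (m : ZMod N → ℤ), (∀ c, m c ≠ 0 → IsUnit c ∧ 0 < c.val ∧ 2 * c.val < N) →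
      ∑ c : ZMod N, (m c : ℝ) *
          blochWignerDilog (Complex.exp (2 * Real.pi * Complex.I / N) ^ c.val) = 0 →
        ∀ c, m c = 0 := by
  intro h N _ m hsupp hsum
  classical
  have hD := ZagierDilogarithmRelationsConjecture.iff_blochWignerDilog'.1 (crux_iff_relationsConjecture.1 h)
  set ζ : ℂ := Complex.exp (2 * Real.pi * Complex.I / N) with hζ
  -- the support family, indexed by `Fin k`
  set S := {c : ZMod N // m c ≠ 0} with hS
  set k := Fintype.card S
  set e : S ≃ Fin k := Fintype.equivFin S
  set z : Fin k → ℂ := fun i => ζ ^ ((e.symm i : ZMod N)).val with hz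
  set n : Fin k → ℤ := fun i => m (e.symm i) with hn
  have halg : ∀ i, IsAlgebraic ℚ (z i) := fun i => isAlgebraic_zeta_pow N _
  have him : ∀ i, 0 < (z i).im := fun i =>
    CyclotomicPrimeSector.zeta_pow_im_pos N (hsupp _ (e.symm i).2).2.1 (hsupp _ (e.symm i).2).2.2
  -- sums over the support family are sums over `ℤ/N`
  have hreindex : ∀ (G : Type) [AddCommMonoid G] (F : ZMod N → ℤ → G), (∀ c, F c 0 = 0) →
      ∑ i, F (e.symm i) (n i) = ∑ c : ZMod N, F c (m c) := by
    intro G _ F hF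
    rw [Fintype.sum_equiv e.symm (fun i => F (e.symm i) (n i)) (fun s : S => F s (m s)) (fun i => rfl),
      ← Finset.sum_subtype (Finset.univ.filter fun c => m c ≠ 0) (by simp)
        (fun c => F c (m c))]
    exact Finset.sum_filter_of_ne fun c _ hc h0 => hc (by rw [h0, hF])
  have hval : ∑ i, (n i : ℝ) * blochWignerDilog (z i) = 0 := by
    have := hreindex ℝ (fun c t => (t : ℝ) * blochWignerDilog (ζ ^ c.val)) (fun c => by simp)
    rw [this]
    exact hsum
  have hmem := hD k z n halg him hval
  have hformal : (∑ i, n i • FreeAbelianGroup.of (z i)) =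
      ∑ c : ZMod N, m c • FreeAbelianGroup.of (ζ ^ c.val) :=
    hreindex (FreeAbelianGroup ℂ) (fun c t => t • FreeAbelianGroup.of (ζ ^ c.val)) (fun c => by simp)
  rw [hformal] at hmem
  exact stub_cyclotomicIndependence N m hsupp hmem

/-- **The crux implies Milnor's conjecture — `ℚ`-linear independence form.** If Zagier's dilogarithm
conjecture holds then for every `N` the Clausen values `D(ζ_N^c)`, `c` a unit of `ℤ/N` with `0 < c < N/2`,
are linearly independent over `ℚ`. [cite: Neumann1998, §2.1] -/
theorem crux_implies_milnor_rational
    (h : Summit.KontsevichZagierPeriods.KontsevichZagierPeriods.Theses.HyperbolicBloch.ZagierDilogarithmConjecture)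
    (N : ℕ) [NeZero N] :
    LinearIndependent ℚ (fun c : {c : ZMod N // IsUnit c ∧ 0 < c.val ∧ 2 * c.val < N} =>
      blochWignerDilog (Complex.exp (2 * Real.pi * Complex.I / N) ^ (c : ZMod N).val)) :=
  (stub_milnorRationalForm N).1 (crux_implies_milnor h N)

/-- **The crux implies Milnor's conjecture in Milnor's own (Lobachevsky) form.** If Zagier's dilogarithm
conjecture holds then for every `N` the values `Л(πc/N)` of the Lobachevsky function at the units `c` of
`ℤ/N` with `0 < c < N/2` are linearly independent over `ℚ` (Milnor 1982, Appendix: "for fixed N the real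
numbers Л(kπ/N), k a unit mod N, 0 < k < N/2, are conjectured to be linearly independent over ℚ";
`D(ζ_N^c) = 2Л(πc/N)`). [cite: Milnor1982, Appendix] -/
theorem crux_implies_milnor_lobachevsky
    (h : Summit.KontsevichZagierPeriods.KontsevichZagierPeriods.Theses.HyperbolicBloch.ZagierDilogarithmConjecture)
    (N : ℕ) [NeZero N] :
    LinearIndependent ℚ (fun c : {c : ZMod N // IsUnit c ∧ 0 < c.val ∧ 2 * c.val < N} =>
      lobachevsky (Real.pi * (c : ZMod N).val / N)) := by
  have hD := crux_implies_milnor_rational h N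
  rw [← MilnorRationalForm.int_form_iff_linearIndependent_rat] at hD ⊢
  intro m hm
  refine hD m ?_
  have e : ∀ c : {c : ZMod N // IsUnit c ∧ 0 < c.val ∧ 2 * c.val < N},
      blochWignerDilog (Complex.exp (2 * Real.pi * Complex.I / N) ^ (c : ZMod N).val) =
        2 * lobachevsky (Real.pi * (c : ZMod N).val / N) :=
    fun c => stub_clausenLobachevsky N _ c.2.2.1 (ZMod.val_lt _)
  simp only [e]
  calc ∑ i, (m i : ℝ) * (2 * lobachevsky (Real.pi * ((i : ZMod N)).val / N))
      = 2 * ∑ i, (m i : ℝ) * lobachevsky (Real.pi * ((i : ZMod N)).val / N) := by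
        rw [Finset.mul_sum]; exact Finset.sum_congr rfl fun i _ => by ring
    _ = 0 := by rw [hm, mul_zero]

/-- **For a prime `p`, the cyclotomic sector of the crux IS Milnor's conjecture for `p`.** Zagier's
conjecture restricted to `p`-th roots of unity in `ℍ⁺` holds if and only if the `D(ζ_p^c)`, `0 < c < p/2`,
are `ℤ`-linearly independent. [cite: Neumann1998, §2.1] -/
theorem cruxCyclotomicPrime_iff_milnor (p : ℕ) [NeZero p] (hp : p.Prime) :
    (∀ (k : ℕ) (u : Fin k → ℂ) (n : Fin k → ℤ), (∀ i, u i ^ p = 1) → (∀ i, 0 < (u i).im) →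
        ∑ i, (n i : ℝ) * blochWignerDilog (u i) = 0 →
          (∑ i, n i • FreeAbelianGroup.of (u i)) ∈ AddSubgroup.closure dilogRelators) ↔
      (∀ m : ZMod p → ℤ, (∀ c, m c ≠ 0 → 0 < c.val ∧ 2 * c.val < p) →
        ∑ c : ZMod p, (m c : ℝ) *
            blochWignerDilog (Complex.exp (2 * Real.pi * Complex.I / p) ^ c.val) = 0 →
          ∀ c, m c = 0) :=
  stub_cyclotomicPrimeSector_iff p hp

/-- **The crux restricted to `p`-th roots of unity follows from the full crux** (so, for prime `p`, the crux
proves Milnor's conjecture for `p` also through the sector equivalence). [folklore] -/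
theorem cruxCyclotomicPrime_of_crux
    (h : Summit.KontsevichZagierPeriods.KontsevichZagierPeriods.Theses.HyperbolicBloch.ZagierDilogarithmConjecture)
    (p : ℕ) [NeZero p] :
    ∀ (k : ℕ) (u : Fin k → ℂ) (n : Fin k → ℤ), (∀ i, u i ^ p = 1) → (∀ i, 0 < (u i).im) →
      ∑ i, (n i : ℝ) * blochWignerDilog (u i) = 0 →
        (∑ i, n i • FreeAbelianGroup.of (u i)) ∈ AddSubgroup.closure dilogRelators := by
  intro k u n hu him hsum
  have hD := ZagierDilogarithmRelationsConjecture.iff_blochWignerDilog'.1 (crux_iff_relationsConjecture.1 h)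
  refine hD k u n (fun i => ?_) him hsum
  obtain ⟨c, -, -, hc⟩ := CyclotomicPrimeSector.exists_eq_zeta_pow p (hu i) (him i)
  rw [hc]
  exact isAlgebraic_zeta_pow p _

/-- **Unconditional low-order sectors.** Zagier's conjecture holds outright for relations among `D`-values
of the `N`-th roots of unity of `ℍ⁺` when `N ∣ 4` (`μ₄ ∩ ℍ⁺ = {i}`) or `N ∣ 6` (`μ₆ ∩ ℍ⁺ = {ζ₆, ζ₃}`,
`3D(ζ₃) = 2D(ζ₆)` explained by the distribution relation); these are exactly the `N` whose primitive
half-system has at most one point. [folklore] -/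
theorem lowOrderSectors :
    (∀ (k : ℕ) (u : Fin k → ℂ) (n : Fin k → ℤ), (∀ i, u i ^ 4 = 1) → (∀ i, 0 < (u i).im) →
        ∑ i, (n i : ℝ) * blochWignerDilog (u i) = 0 →
          (∑ i, n i • FreeAbelianGroup.of (u i)) ∈ AddSubgroup.closure dilogRelators) ∧
      (∀ (k : ℕ) (u : Fin k → ℂ) (n : Fin k → ℤ), (∀ i, u i ^ 6 = 1) → (∀ i, 0 < (u i).im) →
        ∑ i, (n i : ℝ) * blochWignerDilog (u i) = 0 →
          (∑ i, n i • FreeAbelianGroup.of (u i)) ∈ AddSubgroup.closure dilogRelators) :=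
  ⟨stub_quarticSector, stub_sexticSector⟩

/-- **Route level: Milnor's conjecture for a prime `p` implies the KZ period conjecture (kernel form) for the
volumes of the ideal tetrahedra `T(ζ_p^c)`.** For the standard tetrahedral representations `ρ`, if the
`D(ζ_p^c)`, `0 < c < p/2`, are `ℤ`-independent then every `ℤ`-relation among the periods `vol T(u)`,
`u ∈ μ_p ∩ ℍ⁺`, is a KZ relation — TetraSector's conclusion on the `p`-cyclotomic sector, conditional only on
Milnor_p (not on the crux): `value(ρ u) = D(u)`, the sector equivalence, and `stub_explainedToKZ`.
[cite: KontsevichZagier2001, §1.2] -/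
theorem milnor_implies_kzCyclotomicPrime (p : ℕ) [NeZero p] (hp : p.Prime)
    (hM : ∀ m : ZMod p → ℤ, (∀ c, m c ≠ 0 → 0 < c.val ∧ 2 * c.val < p) →
      ∑ c : ZMod p, (m c : ℝ) *
          blochWignerDilog (Complex.exp (2 * Real.pi * Complex.I / p) ^ c.val) = 0 →
        ∀ c, m c = 0) :
    ∀ (T : ℂ → Set (Fin 3 → ℝ)), (∀ z, T z = {p | 0 < p 1 ∧ z.re * p 1 < z.im * p 0 ∧
      z.im * (p 0 - 1) < (z.re - 1) * p 1 ∧ 0 < p 2 ∧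
      0 < z.im * (p 0 ^ 2 + p 1 ^ 2 + p 2 ^ 2 - p 0) + (z.re - Complex.normSq z) * p 1}) →
    ∀ (ρ : ℂ → KZ.IntegralRep 3), (∀ z, IsAlgebraic ℚ z → 0 < z.im →
      (ρ z).domain = T z ∧ Set.EqOn (ρ z).integrand (fun p => 1 / p 2 ^ 3) (T z)) →
    ∀ (k : ℕ) (u : Fin k → ℂ) (n : Fin k → ℤ), (∀ i, u i ^ p = 1) → (∀ i, 0 < (u i).im) →
      ∑ i, (n i : ℝ) * (ρ (u i)).value = 0 →
        (∑ i, n i • KZ.of (ρ (u i))) ∈ KZ.relations := by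
  intro T hT ρ hρ k u n hu him hsum
  have halg : ∀ i, IsAlgebraic ℚ (u i) := fun i => by
    obtain ⟨c, -, -, hc⟩ := CyclotomicPrimeSector.exists_eq_zeta_pow p (hu i) (him i)
    rw [hc]
    exact isAlgebraic_zeta_pow p _
  have hval : ∑ i, (n i : ℝ) * blochWignerDilog (u i) = 0 := by
    rw [← hsum]
    exact Finset.sum_congr rfl fun i _ => by
      rw [SexticKZ.value_eq_blochWignerDilog T hT ρ hρ (halg i) (him i)]
  have hmem := ((stub_cyclotomicPrimeSector_iff p hp).2 hM) k u n hu him hval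
  exact ZagierDilogarithmCertificate.stub_explainedToKZ T hT ρ hρ k u n him hmem

end Summit.KontsevichZagierPeriods.HyperbolicBloch.ZagierDilogarithmCyclotomic

end
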